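import Literature.Probability.Percolation.LonelyClusterExchange
import HarnessLib

/-!
# `NoHeavyLowerTail` (stmt-CriticalPhenomena-4575) — QUANTITATIVE observer-set transfer: the set-champion-stability
# deficit of `q` for an observer set `O` is at most the amount by which its best member beats `q`

Support file (prover `prim-hp-3`, hull-port line, submodularity / LP-duality / Rayleigh-monotonicity seat;
`--supports stmt-CriticalPhenomena-4575`).  No definitions, no named facts, no sorries.

`Literature.….observerSet_le_of_lonelier` (van den Berg–Häggström–Kahn Thm 1.5, corollary): if SOME member `y` of a finite observer
set `O` is no lighter than `c` (`I(y) ≤ I(c)`, `I(x) = μ{|π(x)| ≤ j}`), then `CS(O, c)`: `μ(c ↮ O, 1 ≤ |π(O)| ≤ j) ≤ μ(c ↮ O, |π(c)| ≤ j)`.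
This file proves the QUANTITATIVE form, with no hypothesis at all:

* `HullPort.setCS_deficit_le_excess` — **for every `y ∈ O`:  `μ(c ↮ O, 1 ≤ |π(O)| ≤ j) ≤ μ(c ↮ O, |π(c)| ≤ j) + max 0 (I(y) − I(c))`.**
  Equivalently `CS(O, c) ≥ −[min_{y ∈ O} I(y) − I(c)]⁺`: the deficit is at most the overtaking of `c` by the LEAST light member of `O`.
  Proof: the same lonely-cluster exchange as the qualitative lemma (`lonelyClusterExchange_typeMinus` for the pair `(y, c)` with the
  type-`(−)` event `X = ⋃_{x ∈ O ∖ y} {c ↔ x}`), read as a product inequality `a·P ≤ Q·d`; when `I(c) < I(y)` one has `Q ≤ P`, hence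
  `a ≤ d`, and the bookkeeping `μ(R_y ∖ D) = μ(R_c ∖ D)` (`D = {y ↮ c}`) turns this into the claim with the additive error `I(y) − I(c)`.
  WHY (crux notes HULLPORT-REF-gen3.md §5–§6): for a cell of the two-sided kernel with glued blocks `y, z` and witness `q` this gives
  `c(T,S) ≥ min(0, max(d_y, d_z))` (`d_v = I(q) − I(v)`), which dominates BOTH the glued-pair margin `min(d_y, d_z)`
  (`HullPort.lightness_margin_glue_ge_max_any`) when both blocks beat `q` AND the sign lemma; at ROW level (conditioning on star 1,
  `T ≠ ∅`) it reads `m₁(T) ≥ min(0, h_T)` with `h_T` the hypothesis cell of the open ports — the cleanest form of the row toolbox.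
* `HullPort.setCS_ge_min_zero` — the same with the `min` packaged: `μ(bad ∧ sep) − μ(light ∧ sep) ≤ max 0 (I(y) − I(c))`.
-/

noncomputable section

namespace Summit.CriticalPhenomena.PercolationContinuityZ3.Theorems

open MeasureTheory Set Literature.Probability.LatticeModels Literature.Probability.Percolation
open Literature.Probability.Percolation.LonelyClusterExchange
open scoped Classical BigOperators

variable {n : ℕ}

namespace HullPort

/-- **Quantitative observer-set transfer.**  For a finite observer set `O`, ANY member `y ∈ O` and any vertex `c`:
`μ(c ↮ O, 1 ≤ |π(O)| ≤ j) ≤ μ(c ↮ O, |π(c)| ≤ j) + max 0 (μ{|π(y)| ≤ j} − μ{|π(c)| ≤ j})`.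
(With `I(y) ≤ I(c)` this is `observerSet_le_of_lonelier`; in general the deficit is at most the excess lightness of `y` over `c`.)
[cite: VandenbergHaggstromKahn2005, Thm. 1.5 (p. 7) — via `lonelyClusterExchange_typeMinus`; this work] -/
theorem setCS_deficit_le_excess (w : Sym2 (Fin n) → unitInterval) (A O : Finset (Fin n)) (y c : Fin n) (hy : y ∈ O) (j : ℕ) :
    (prodBernoulli w).real {ω : BondConfig (Fin n) | (∀ x ∈ O, ω ∉ openConn c x) ∧
        1 ≤ (A.filter fun z => ∃ x ∈ O, ω ∈ openConn x z).card ∧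
        (A.filter fun z => ∃ x ∈ O, ω ∈ openConn x z).card ≤ j} ≤
      (prodBernoulli w).real {ω : BondConfig (Fin n) | (∀ x ∈ O, ω ∉ openConn c x) ∧
        (A.filter fun z => ω ∈ openConn c z).card ≤ j} +
      max 0 ((prodBernoulli w).real {ω : BondConfig (Fin n) | (A.filter fun z => ω ∈ openConn y z).card ≤ j} -
        (prodBernoulli w).real {ω : BondConfig (Fin n) | (A.filter fun z => ω ∈ openConn c z).card ≤ j}) := by
  by_cases hle : (prodBernoulli w).real {ω : BondConfig (Fin n) | (A.filter fun z => ω ∈ openConn y z).card ≤ j} ≤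
      (prodBernoulli w).real {ω : BondConfig (Fin n) | (A.filter fun z => ω ∈ openConn c z).card ≤ j}
  · have h := observerSet_le_of_lonelier w A O y c hy j hle
    have h0 : (0 : ℝ) ≤ max 0 ((prodBernoulli w).real {ω : BondConfig (Fin n) | (A.filter fun z => ω ∈ openConn y z).card ≤ j} -
        (prodBernoulli w).real {ω : BondConfig (Fin n) | (A.filter fun z => ω ∈ openConn c z).card ≤ j}) := le_max_left _ _
    have h' : (prodBernoulli w).real {ω : BondConfig (Fin n) | (∀ x ∈ O, ω ∉ openConn c x) ∧
        1 ≤ (A.filter fun z => ∃ x ∈ O, ω ∈ openConn x z).card ∧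
        (A.filter fun z => ∃ x ∈ O, ω ∈ openConn x z).card ≤ j} ≤
      (prodBernoulli w).real {ω : BondConfig (Fin n) | (∀ x ∈ O, ω ∉ openConn c x) ∧
        (A.filter fun z => ω ∈ openConn c z).card ≤ j} := by convert h using 12
    linarith
  rw [not_le] at hle
  rw [max_eq_right (by linarith)]
  set μ := prodBernoulli w with hμ
  set Rc : Set (BondConfig (Fin n)) := {ω | (A.filter fun z => ω ∈ openConn c z).card ≤ j} with hRc
  set Ry : Set (BondConfig (Fin n)) := {ω | (A.filter fun z => ω ∈ openConn y z).card ≤ j} with hRy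
  set D : Set (BondConfig (Fin n)) := (openConn y c)ᶜ with hD
  set X : Set (BondConfig (Fin n)) := ⋃ x ∈ O.erase y, (openConn c x : Set (BondConfig (Fin n))) with hX
  have hXtype : ∀ ⦃ω ω' : BondConfig (Fin n)⦄, openEdgeCluster ω' y ⊆ openEdgeCluster ω y →
      openEdgeCluster ω c ⊆ openEdgeCluster ω' c → ω ∈ X → ω' ∈ X := by
    intro ω ω' h1 h2 hω
    rw [hX, mem_iUnion₂] at hω ⊢
    obtain ⟨x, hx, hωx⟩ := hω
    exact ⟨x, hx, typeMinus_openConn y c x h1 h2 hωx⟩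
  have hmeas : ∀ S : Set (BondConfig (Fin n)), MeasurableSet S := fun S => (Set.toFinite S).measurableSet
  have hyc : y ≠ c := by
    intro h; subst h; exact lt_irrefl _ hle
  have hsymm : (openConn y c : Set (BondConfig (Fin n))) = openConn c y :=
    Set.ext fun _ => ⟨SimpleGraph.Reachable.symm, SimpleGraph.Reachable.symm⟩
  -- `{c ↮ O} = D ∩ Xᶜ`
  have hG : ∀ ω : BondConfig (Fin n), (∀ x ∈ O, ω ∉ openConn c x) ↔ (ω ∈ D ∧ ω ∉ X) := by
    intro ω
    rw [hD, hX, hsymm, mem_compl_iff, mem_iUnion₂]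
    constructor
    · intro h
      refine ⟨h y hy, ?_⟩
      rintro ⟨x, hx, hωx⟩
      exact h x (Finset.mem_of_mem_erase hx) hωx
    · rintro ⟨h1, h2⟩ x hx
      by_cases hxy : x = y
      · subst hxy; exact h1
      · exact fun hωx => h2 ⟨x, Finset.mem_erase.2 ⟨hxy, hx⟩, hωx⟩
  have hR : {ω : BondConfig (Fin n) | (∀ x ∈ O, ω ∉ openConn c x) ∧
      (A.filter fun z => ω ∈ openConn c z).card ≤ j} = (Rc ∩ D) \ X := by
    ext ω
    simp only [mem_setOf_eq, mem_sdiff, mem_inter_iff, hG ω, hRc]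
    tauto
  have hL : {ω : BondConfig (Fin n) | (∀ x ∈ O, ω ∉ openConn c x) ∧
      1 ≤ (A.filter fun z => ∃ x ∈ O, ω ∈ openConn x z).card ∧
      (A.filter fun z => ∃ x ∈ O, ω ∈ openConn x z).card ≤ j} ⊆ (Ry ∩ D) \ X := by
    intro ω hω
    obtain ⟨hG', -, hU⟩ := hω
    obtain ⟨hD', hX'⟩ := (hG ω).1 hG'
    simp only [hRy, mem_sdiff, mem_inter_iff, mem_setOf_eq]
    refine ⟨⟨le_trans (Finset.card_le_card ?_) hU, hD'⟩, hX'⟩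
    intro z hz
    rw [Finset.mem_filter] at hz ⊢
    exact ⟨hz.1, y, hy, hz.2⟩
  rw [hR]
  refine le_trans (measureReal_mono hL) ?_
  -- the exchange as a product inequality, pair `(y, c)`, type-`(−)` event `X`
  have key : μ.real (D ∩ (Rc ∩ X)) * μ.real (D ∩ Ry) ≤ μ.real (D ∩ Rc) * μ.real (D ∩ (X ∩ Ry)) :=
    lonelyClusterExchange_typeMinus w hyc A j hXtype
  have hF2 : Rc \ D = Ry \ D := by
    ext ω
    simp only [hRc, hRy, hD, mem_sdiff, mem_compl_iff, not_not, mem_setOf_eq]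
    constructor
    · rintro ⟨h, hyc'⟩
      have hyc'' : (openGraph ω).Reachable y c := hyc'
      have heq : (A.filter fun z => ω ∈ openConn y z) = (A.filter fun z => ω ∈ openConn c z) :=
        Finset.filter_congr fun z _ =>
          ⟨fun hz => (hyc''.symm.trans hz : (openGraph ω).Reachable c z),
            fun hz => (hyc''.trans hz : (openGraph ω).Reachable y z)⟩
      rw [heq]
      exact ⟨h, hyc'⟩
    · rintro ⟨h, hyc'⟩
      have hyc'' : (openGraph ω).Reachable y c := hyc'
      have heq : (A.filter fun z => ω ∈ openConn c z) = (A.filter fun z => ω ∈ openConn y z) :=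
        Finset.filter_congr fun z _ =>
          ⟨fun hz => (hyc''.trans hz : (openGraph ω).Reachable y z),
            fun hz => (hyc''.symm.trans hz : (openGraph ω).Reachable c z)⟩
      rw [heq]
      exact ⟨h, hyc'⟩
  have hc1 : μ.real (Rc ∩ D) + μ.real (Rc \ D) = μ.real Rc := measureReal_inter_add_sdiff (hmeas D)
  have hy1 : μ.real (Ry ∩ D) + μ.real (Ry \ D) = μ.real Ry := measureReal_inter_add_sdiff (hmeas D)
  have hc2 : μ.real (Rc ∩ D ∩ X) + μ.real ((Rc ∩ D) \ X) = μ.real (Rc ∩ D) :=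
    measureReal_inter_add_sdiff (hmeas X)
  have hy2 : μ.real (Ry ∩ D ∩ X) + μ.real ((Ry ∩ D) \ X) = μ.real (Ry ∩ D) :=
    measureReal_inter_add_sdiff (hmeas X)
  have e1 : Rc ∩ D ∩ X = D ∩ (Rc ∩ X) := by
    ext ω; simp only [mem_inter_iff]; tauto
  have e4 : Ry ∩ D ∩ X = D ∩ (X ∩ Ry) := by
    ext ω; simp only [mem_inter_iff]; tauto
  have e2 : D ∩ Rc = Rc ∩ D := inter_comm _ _
  have e3 : D ∩ Ry = Ry ∩ D := inter_comm _ _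
  rw [e1] at hc2
  rw [e4] at hy2
  rw [hF2] at hc1
  rw [e2, e3] at key
  -- `Q := μ(Rc ∩ D) ≤ P := μ(Ry ∩ D)` since `μ Rc < μ Ry` and `Rc \ D = Ry \ D`
  have hQP : μ.real (Rc ∩ D) ≤ μ.real (Ry ∩ D) := by linarith
  -- from `a·P ≤ Q·d`, `Q ≤ P`, `0 ≤ d`: `a ≤ d`
  have had : μ.real (D ∩ (Rc ∩ X)) ≤ μ.real (D ∩ (X ∩ Ry)) := by
    by_cases hP : μ.real (Ry ∩ D) = 0
    · have hQ0 : μ.real (Rc ∩ D) = 0 := le_antisymm (hP ▸ hQP) measureReal_nonneg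
      have ha : μ.real (D ∩ (Rc ∩ X)) ≤ μ.real (Rc ∩ D) := by
        rw [← e2]; exact measureReal_mono (inter_subset_inter_right _ inter_subset_left) (measure_ne_top _ _)
      linarith [measureReal_nonneg (μ := μ) (s := D ∩ (X ∩ Ry))]
    · have hpos : 0 < μ.real (Ry ∩ D) := lt_of_le_of_ne measureReal_nonneg (Ne.symm hP)
      have h' : μ.real (D ∩ (Rc ∩ X)) * μ.real (Ry ∩ D) ≤ μ.real (Ry ∩ D) * μ.real (D ∩ (X ∩ Ry)) := by
        nlinarith [measureReal_nonneg (μ := μ) (s := D ∩ (X ∩ Ry))]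
      rw [mul_comm] at h'
      exact le_of_mul_le_mul_left h' hpos
  linarith

/-- **Set-champion stability up to the excess of the best member (difference form).**  For `y ∈ O`:
`μ(c ↮ O, 1 ≤ |π(O)| ≤ j) − μ(c ↮ O, |π(c)| ≤ j) ≤ max 0 (I(y) − I(c))`; i.e. `CS(O, c) ≥ min(0, I(c) − I(y))` for every member `y`.
[cite: VandenbergHaggstromKahn2005, Thm. 1.5 (p. 7) — via `lonelyClusterExchange_typeMinus`; this work] -/
theorem setCS_ge_min_zero (w : Sym2 (Fin n) → unitInterval) (A O : Finset (Fin n)) (y c : Fin n) (hy : y ∈ O) (j : ℕ) :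
    (prodBernoulli w).real {ω : BondConfig (Fin n) | (∀ x ∈ O, ω ∉ openConn c x) ∧
        1 ≤ (A.filter fun z => ∃ x ∈ O, ω ∈ openConn x z).card ∧
        (A.filter fun z => ∃ x ∈ O, ω ∈ openConn x z).card ≤ j} -
      (prodBernoulli w).real {ω : BondConfig (Fin n) | (∀ x ∈ O, ω ∉ openConn c x) ∧
        (A.filter fun z => ω ∈ openConn c z).card ≤ j} ≤
      max 0 ((prodBernoulli w).real {ω : BondConfig (Fin n) | (A.filter fun z => ω ∈ openConn y z).card ≤ j} -
        (prodBernoulli w).real {ω : BondConfig (Fin n) | (A.filter fun z => ω ∈ openConn c z).card ≤ j}) := by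
  have h := setCS_deficit_le_excess w A O y c hy j
  linarith

end HullPort

end Summit.CriticalPhenomena.PercolationContinuityZ3.Theorems
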